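import Literature.AlgebraicGeometry.HodgeTheory.CompleteIntersectionHilbertFunction
import Literature.AlgebraicGeometry.HodgeTheory.DiagonalSymmetryEigenHodgeNumbers
import Literature.RingTheory.MvPolynomial.HomogeneousHilbertFunction
import Literature.AlgebraicGeometry.Motives.UniversalHypersurfaceFamily
import HarnessLib

/-!
# The sign-refined Hilbert function of an Artinian complete intersection of eigenforms, and of the
# Jacobian ring of a form with a sign symmetry (Macaulay / Philippon on the `±1`-parts)

Family `hodge`, layer `Literature/AlgebraicGeometry/HodgeTheory`; sequel to `CompleteIntersectionHilbertFunction`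
(`hilbert_span_eq_card_of_degrees`, `hilbert_jacobianIdeal_eq_card`: the Hilbert function of an Artinian complete
intersection depends only on the degrees and is the Fermat box count; `mem_ofList_take_of_mul_mem`: finite quotient
⇒ regular sequence) and `RingTheory/MvPolynomial/HomogeneousHilbertFunction` (`idealDegree_sup_span_singleton`,
`idealDegree_inf_map_mulLeft_eq`: Philippon's hypersurface-section identities), refined by the CHARACTER of a
diagonal sign symmetry `a ∈ (ℂˣ)^{n+2}`, `a² = 1`, acting on `S = ℂ[x₀, …, x_{n+1}]` by `P ↦ P(a • x)` (the tree's
`diagonalSubst`, file `DiagonalSymmetry`). THEOREMS ONLY (no definition, no named fact; net debt `0`). Written for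
the cell `hodge-nonav` (route `SignSymmetricPowers`, crux K1 line `andre-zariski` v5, registered stub
`stub_signDeckHodge`: the eigen-Hodge numbers of the sign involution `ι = diag(−1,−1,1,1,1)` of a smooth `ι`-even
hypersurface threefold are, by the equivariant Griffiths–Voisin residue theorem (named fact
`voisin2003_finrank_eigenspace_inf_hodgePiece_of_diagonalStabilizer`, file `HypersurfaceEigenHodgeNumbersJacobian`),
the dimensions of the `ι`-parity parts of the Jacobian ring `S/J_f` in degrees `(q+1)d − 5`; this file computes
those dimensions).

Sources. J. Carlson, S. Müller-Stach, C. Peters, *Period Mappings and Period Domains* (2nd ed., 2017)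
[CarlsonMullerStachPeters2017], §7.4 Thm. 7.4.1 (Macaulay) and its proof ("the standard example is the sequence of
the partial derivatives of a smooth hypersurface"); P. Philippon, Bull. SMF 114 (1986) [Philippon1986], Lemme 3.1
(the exact sequence `0 → (S/I)_t →·Q (S/I)_{t+q} → (S/(I,Q))_{t+q} → 0` for a non-zero-divisor `Q`);
C. Voisin, *Hodge Theory and Complex Algebraic Geometry II* [VoisinHodgeII2003], §6.2.2 (the Jacobian ideal of a
smooth hypersurface is generated by a regular sequence, `R_f` Artinian); H. Movasati, arXiv:1602.06607
[Movasati2016Periods], Definition 1 (the box count `#I_N`); J.-P. Serre, *Linear Representations of Finite Groups*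
[SerreLinearRepresentations1977], §2.6 (canonical decomposition; for the group `{1, ι}` the projectors
`½(1 ± ι)`). The refinement is the observation that all maps in Philippon's sequence are `ι`-equivariant up to
the sign of `Q` when `I` is `ι`-stable and `Q` is an eigenform, so the sequence splits into `±1`-parts, and that
the monomials are a common eigenbasis of `S_t` and of the monomial complete intersection `(x_i^{d_i})`.

## What is proved (`S = ℂ[x₀, …, x_{n+1}]`, `ι = aeval (diagonalSubst a)`, `E_c = eigenspace ι c`)

* §1 linear algebra of an involution on stable subspaces: `A = A₊ ⊕ A₋`, `dim A = dim A₊ + dim A₋`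
  (`finrank_eq_finrank_inf_eigenspace_add`), `(A + B)_c = A_c + B_c` (`sup_inf_eigenspace_eq`), transport along a
  twisted-equivariant injection (`map_inf_eigenspace_eq`);
* §2 `ι` on coefficients / monomials, its eigenspaces (`mem_eigenspace_aeval_diagonalSubst_iff`,
  `eigenspace_aeval_diagonalSubst_eq_restrictSupport`), stability of `S_t`, of ideals generated by eigenforms and
  of their degree pieces;
* §3 **`finrank_idealDegree_sup_span_inf_eigenspace_add_eq`** — Philippon's formula on eigen-parts:
  `dim ((I + (Q))_{t+q})_c + dim (I_t)_{cε} = dim (I_{t+q})_c + dim (S_t)_{cε}` (`ιQ = εQ`, `Q` a non-zero-divisor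
  modulo the homogeneous `ι`-stable `I`);
* §4 **`hilbertSign_span_eq_of_X_pow_mem`** — the sign-refined Hilbert function `dim (S_t)_c − dim ((G)_t)_c` of
  an Artinian complete intersection of eigenforms depends only on the degrees and signs (induction over the partial
  ideals `(G_0, …, G_{k−1})`, finite quotient ⇒ regular sequence from the tree);
* §5 counts: `dim (S_t)_c = #{β : |β| = t, a^β = c}`, the monomial complete intersection, and
  **`hilbertSign_span_X_pow_eq_card`**;
* §6 **`hilbertSign_span_eq_card_of_degrees`** — `dim (S_t)_c − dim ((G)_t)_c = #{β : |β| = t, βᵢ ≤ dᵢ − 1, a^β = c}`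
  for eigenforms `G_i` of degrees `d_i` with `G_i(a • x) = aᵢ^{dᵢ} G_i`;
* §7 `(∂ᵢf)(a • x) = aᵢ⁻¹ ∂ᵢf` for `a`-invariant `f` (scalar form of the tree's chain rule), and
  **`hilbertSign_jacobianIdeal_eq_card`** — for an `a`-invariant form `f` of degree `d ≥ 2` with `aᵢᵈ = 1` and
  Artinian Jacobian ring: `dim (S_t)_c − dim ((J_f)_t)_c = #{β : |β| = t, βᵢ ≤ d − 2, a^β = c}`, `c = ±1`.

NOT here: symmetries of order `> 2` (the projectors are then Lagrange polynomials in `ι`; only the `±1` case is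
needed by the consumer), the identification with eigen-Hodge numbers (the named fact), the consumer's closed form
(a `List.foldl` generating-function evaluation of the count, route-side).
-/

noncomputable section

open MvPolynomial Module
open Literature.RingTheory.MvPolynomial Literature.AlgebraicGeometry.Motives


namespace Literature.AlgebraicGeometry.HodgeTheory

/-! ## §1 Linear algebra of an involution: eigenspace decomposition of stable subspaces -/

section Involution

variable {K : Type*} [Field K] [NeZero (2 : K)] {V : Type*} [AddCommGroup V] [Module K V]

omit [NeZero (2 : K)] in
/-- For an involution `ι` and an `ι`-stable subspace `A`, the symmetrisation `x + ι x` of `x ∈ A` lies in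
`A ∩ E₁(ι)`. [cite: SerreLinearRepresentations1977, §2.6 Thm. 8 (canonical decomposition, group of order 2)] -/
theorem add_apply_mem_inf_eigenspace_one {ι : V →ₗ[K] V} (hι : ∀ x, ι (ι x) = x) {A : Submodule K V}
    (hA : ∀ x ∈ A, ι x ∈ A) {x : V} (hx : x ∈ A) : x + ι x ∈ A ⊓ Module.End.eigenspace ι 1 :=
  Submodule.mem_inf.2 ⟨A.add_mem hx (hA x hx), by
    rw [Module.End.mem_eigenspace_iff, map_add, hι, one_smul, add_comm]⟩

omit [NeZero (2 : K)] in
/-- For an involution `ι` and an `ι`-stable subspace `A`, the antisymmetrisation `x − ι x` of `x ∈ A` lies in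
`A ∩ E₋₁(ι)`. [cite: SerreLinearRepresentations1977, §2.6 Thm. 8 (canonical decomposition, group of order 2)] -/
theorem sub_apply_mem_inf_eigenspace_neg_one {ι : V →ₗ[K] V} (hι : ∀ x, ι (ι x) = x) {A : Submodule K V}
    (hA : ∀ x ∈ A, ι x ∈ A) {x : V} (hx : x ∈ A) : x - ι x ∈ A ⊓ Module.End.eigenspace ι (-1) :=
  Submodule.mem_inf.2 ⟨A.sub_mem hx (hA x hx), by
    rw [Module.End.mem_eigenspace_iff, map_sub, hι, neg_one_smul, neg_sub]⟩

/-- **An `ι`-stable subspace is the sum of its `±1`-parts** (`x = ½(x + ιx) + ½(x − ιx)`, `2 ≠ 0`).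
[cite: SerreLinearRepresentations1977, §2.6 Thm. 8 (canonical decomposition, group of order 2)] -/
theorem inf_eigenspace_sup_inf_eigenspace_eq {ι : V →ₗ[K] V} (hι : ∀ x, ι (ι x) = x) {A : Submodule K V}
    (hA : ∀ x ∈ A, ι x ∈ A) :
    (A ⊓ Module.End.eigenspace ι 1) ⊔ (A ⊓ Module.End.eigenspace ι (-1)) = A := by
  refine le_antisymm (sup_le inf_le_left inf_le_left) fun x hx ↦ ?_
  have h2 : (2 : K) ≠ 0 := NeZero.ne 2
  have hx' : x = (2 : K)⁻¹ • (x + ι x) + (2 : K)⁻¹ • (x - ι x) := by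
    rw [← smul_add, add_add_sub_cancel, ← two_smul K x, smul_smul, inv_mul_cancel₀ h2, one_smul]
  rw [hx']
  exact Submodule.add_mem_sup (Submodule.smul_mem _ _ (add_apply_mem_inf_eigenspace_one hι hA hx))
    (Submodule.smul_mem _ _ (sub_apply_mem_inf_eigenspace_neg_one hι hA hx))

/-- The `+1`- and `−1`-eigenspaces of an endomorphism are disjoint (`2 ≠ 0`). [cite: SerreLinearRepresentations1977, §2.6 Thm. 8 (canonical decomposition, group of order 2)] -/
theorem disjoint_eigenspace_one_neg_one (ι : V →ₗ[K] V) :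
    Disjoint (Module.End.eigenspace ι 1) (Module.End.eigenspace ι (-1)) := by
  rw [Submodule.disjoint_def]
  intro x h1 h2
  rw [Module.End.mem_eigenspace_iff] at h1 h2
  rw [h1, one_smul, neg_one_smul, eq_neg_iff_add_eq_zero, ← two_smul K x, smul_eq_zero] at h2
  exact h2.resolve_left (NeZero.ne 2)

/-- **`dim A = dim A₊ + dim A₋`** for an `ι`-stable finite-dimensional subspace `A` of an involution `ι`.
[cite: SerreLinearRepresentations1977, §2.6 Thm. 8 (canonical decomposition, group of order 2)] -/
theorem finrank_eq_finrank_inf_eigenspace_add {ι : V →ₗ[K] V} (hι : ∀ x, ι (ι x) = x) (A : Submodule K V)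
    [FiniteDimensional K A] (hA : ∀ x ∈ A, ι x ∈ A) :
    finrank K A = finrank K ↥(A ⊓ Module.End.eigenspace ι 1) + finrank K ↥(A ⊓ Module.End.eigenspace ι (-1)) := by
  haveI : FiniteDimensional K ↥(A ⊓ Module.End.eigenspace ι 1) :=
    Submodule.finiteDimensional_of_le inf_le_left
  haveI : FiniteDimensional K ↥(A ⊓ Module.End.eigenspace ι (-1)) :=
    Submodule.finiteDimensional_of_le inf_le_left
  have h := Submodule.finrank_sup_add_finrank_inf_eq (A ⊓ Module.End.eigenspace ι 1)
    (A ⊓ Module.End.eigenspace ι (-1))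
  have hbot : (A ⊓ Module.End.eigenspace ι 1) ⊓ (A ⊓ Module.End.eigenspace ι (-1)) = ⊥ :=
    ((disjoint_eigenspace_one_neg_one ι).mono inf_le_right inf_le_right).eq_bot
  rw [hbot, finrank_bot, add_zero, inf_eigenspace_sup_inf_eigenspace_eq hι hA] at h
  exact h

omit [NeZero (2 : K)] in
/-- The projector `x ↦ x + c ιx` (`c = ±1`) maps an `ι`-stable subspace into its `c`-part. [cite: SerreLinearRepresentations1977, §2.6 Thm. 8 (canonical decomposition, group of order 2)] -/
theorem add_smul_apply_mem_inf_eigenspace {ι : V →ₗ[K] V} (hι : ∀ x, ι (ι x) = x) {A : Submodule K V}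
    (hA : ∀ x ∈ A, ι x ∈ A) {c : K} (hc : c = 1 ∨ c = -1) {x : V} (hx : x ∈ A) :
    x + c • ι x ∈ A ⊓ Module.End.eigenspace ι c := by
  rcases hc with rfl | rfl
  · rw [one_smul]; exact add_apply_mem_inf_eigenspace_one hι hA hx
  · rw [neg_one_smul, ← sub_eq_add_neg]; exact sub_apply_mem_inf_eigenspace_neg_one hι hA hx

/-- **`(A + B)_c = A_c + B_c`** for `ι`-stable subspaces `A`, `B` of an involution `ι` and `c = ±1`.
[cite: SerreLinearRepresentations1977, §2.6 Thm. 8 (canonical decomposition, group of order 2)] -/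
theorem sup_inf_eigenspace_eq {ι : V →ₗ[K] V} (hι : ∀ x, ι (ι x) = x) {A B : Submodule K V}
    (hA : ∀ x ∈ A, ι x ∈ A) (hB : ∀ x ∈ B, ι x ∈ B) {c : K} (hc : c = 1 ∨ c = -1) :
    (A ⊔ B) ⊓ Module.End.eigenspace ι c = (A ⊓ Module.End.eigenspace ι c) ⊔ (B ⊓ Module.End.eigenspace ι c) := by
  refine le_antisymm ?_ (sup_le (inf_le_inf_right _ le_sup_left) (inf_le_inf_right _ le_sup_right))
  intro x hx'
  obtain ⟨hx, hxc⟩ := Submodule.mem_inf.1 hx'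
  obtain ⟨α, hα, β, hβ, rfl⟩ := Submodule.mem_sup.mp hx
  have h2 : (2 : K) ≠ 0 := NeZero.ne 2
  rw [Module.End.mem_eigenspace_iff] at hxc
  have hc2 : c * c = 1 := by rcases hc with rfl | rfl <;> simp
  -- `x = ½ (x + c ι x)`, and `y ↦ y + c ι y` splits over `α + β`
  have hx' : α + β = (2 : K)⁻¹ • ((α + c • ι α) + (β + c • ι β)) := by
    rw [add_add_add_comm, ← smul_add, ← map_add, hxc, smul_smul, hc2, one_smul, ← two_smul K (α + β),
      smul_smul, inv_mul_cancel₀ h2, one_smul]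
  rw [hx']
  exact Submodule.smul_mem _ _ (Submodule.add_mem_sup (add_smul_apply_mem_inf_eigenspace hι hA hc hα)
    (add_smul_apply_mem_inf_eigenspace hι hB hc hβ))

omit [NeZero (2 : K)] in
/-- **Transport of eigen-parts along a twisted-equivariant injection**: if `M` is injective and
`ι (M y) = ε M (ι y)` (`ε = ±1`), then `(M A)_c = M (A_{cε})` for every subspace `A`. [cite: SerreLinearRepresentations1977, §2.6 Thm. 8 (canonical decomposition, group of order 2)] -/
theorem map_inf_eigenspace_eq {ι : V →ₗ[K] V} (M : V →ₗ[K] V) (hM : Function.Injective M)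
    {ε c : K} (hε : ε = 1 ∨ ε = -1) (hcomm : ∀ y, ι (M y) = ε • M (ι y)) (A : Submodule K V) :
    A.map M ⊓ Module.End.eigenspace ι c = (A ⊓ Module.End.eigenspace ι (c * ε)).map M := by
  have hε2 : ε * ε = 1 := by rcases hε with rfl | rfl <;> simp
  ext x
  simp only [Submodule.mem_inf, Submodule.mem_map, Module.End.mem_eigenspace_iff]
  constructor
  · rintro ⟨⟨y, hy, rfl⟩, hcy⟩
    refine ⟨y, ⟨hy, hM ?_⟩, rfl⟩
    rw [map_smul, mul_comm, mul_smul, ← hcy, hcomm, smul_smul, hε2, one_smul]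
  · rintro ⟨y, ⟨hy, hcy⟩, rfl⟩
    refine ⟨⟨y, hy, rfl⟩, ?_⟩
    rw [hcomm, hcy, map_smul, smul_smul, mul_comm ε, mul_assoc, hε2, mul_one]

end Involution

/-! ## §2 The diagonal substitution `P ↦ P(a • x)`: coefficients, eigenspaces, stability -/

section Subst

variable {n : ℕ}

/-- **`P ↦ P(a • x)` on coefficients**: `coeff_β (P(a • x)) = a^β · coeff_β P`, `a^β = ∏ aᵢ^{βᵢ}`. [cite: SerreLinearRepresentations1977, §2.6 Thm. 8 (eigenspaces of a diagonal action)] -/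
theorem coeff_aeval_diagonalSubst (a : Fin (n + 2) → ℂˣ) (β : Fin (n + 2) →₀ ℕ)
    (P : MvPolynomial (Fin (n + 2)) ℂ) :
    coeff β (aeval (diagonalSubst a) P) = (∏ i, ((a i : ℂˣ) : ℂ) ^ β i) * coeff β P := by
  classical
  induction P using MvPolynomial.induction_on' with
  | monomial γ r =>
    have hmon : aeval (diagonalSubst a) (monomial γ r) =
        monomial γ ((∏ i, ((a i : ℂˣ) : ℂ) ^ γ i) * r) := by
      rw [aeval_monomial, Finsupp.prod_fintype _ _ (fun i ↦ by simp), algebraMap_eq]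
      simp only [diagonalSubst_apply, mul_pow, ← C_pow, Finset.prod_mul_distrib, ← map_prod C]
      rw [monomial_eq, Finsupp.prod_fintype _ _ (fun i ↦ by simp), C_mul]
      ring
    rw [hmon, coeff_monomial, coeff_monomial]
    split_ifs with h
    · subst h; rfl
    · rw [mul_zero]
  | add p q hp hq => rw [map_add, coeff_add, coeff_add, hp, hq, mul_add]

/-- **The eigenvectors of `P ↦ P(a • x)`**: `P` has eigenvalue `c` iff every monomial `x^β` of its support has
`a^β = c`. [cite: SerreLinearRepresentations1977, §2.6 Thm. 8 (eigenspaces of a diagonal action)] -/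
theorem mem_eigenspace_aeval_diagonalSubst_iff (a : Fin (n + 2) → ℂˣ) (c : ℂ) (P : MvPolynomial (Fin (n + 2)) ℂ) :
    P ∈ Module.End.eigenspace (aeval (diagonalSubst a)).toLinearMap c ↔
      ∀ β ∈ P.support, (∏ i, ((a i : ℂˣ) : ℂ) ^ β i) = c := by
  rw [Module.End.mem_eigenspace_iff, AlgHom.toLinearMap_apply, MvPolynomial.ext_iff]
  refine ⟨fun h β hβ ↦ ?_, fun h β ↦ ?_⟩
  · have hβ' := h β
    rw [coeff_aeval_diagonalSubst, coeff_smul, smul_eq_mul] at hβ'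
    exact mul_right_cancel₀ (mem_support_iff.mp hβ) hβ'
  · rw [coeff_aeval_diagonalSubst, coeff_smul, smul_eq_mul]
    by_cases hβ : β ∈ P.support
    · rw [h β hβ]
    · rw [notMem_support_iff.mp hβ, mul_zero, mul_zero]

/-- The eigenspace of `P ↦ P(a • x)` for `c` is the space of polynomials supported on `{β | a^β = c}`
(Mathlib `restrictSupport`). [cite: SerreLinearRepresentations1977, §2.6 Thm. 8 (eigenspaces of a diagonal action)] -/
theorem eigenspace_aeval_diagonalSubst_eq_restrictSupport (a : Fin (n + 2) → ℂˣ) (c : ℂ) :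
    Module.End.eigenspace (aeval (diagonalSubst a)).toLinearMap c =
      restrictSupport ℂ {β : Fin (n + 2) →₀ ℕ | (∏ i, ((a i : ℂˣ) : ℂ) ^ β i) = c} := by
  ext P
  rw [mem_eigenspace_aeval_diagonalSubst_iff, mem_restrictSupport_iff]
  exact ⟨fun h β hβ ↦ h β (Finset.mem_coe.mp hβ), fun h β hβ ↦ h (Finset.mem_coe.mpr hβ)⟩

/-- A sign vector (`a * a = 1`) gives an involution `P ↦ P(a • x)`. [cite: SerreLinearRepresentations1977, §2.6 Thm. 8 (eigenspaces of a diagonal action)] -/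
theorem aeval_diagonalSubst_aeval_diagonalSubst_self {a : Fin (n + 2) → ℂˣ} (ha : a * a = 1)
    (P : MvPolynomial (Fin (n + 2)) ℂ) : aeval (diagonalSubst a) (aeval (diagonalSubst a) P) = P := by
  rw [aeval_diagonalSubst_aeval_diagonalSubst, ha, aeval_diagonalSubst_one]

/-- `P ↦ P(a • x)` preserves the forms of degree `t`. [cite: SerreLinearRepresentations1977, §2.6 Thm. 8 (eigenspaces of a diagonal action)] -/
theorem aeval_diagonalSubst_mem_homogeneousSubmodule (a : Fin (n + 2) → ℂˣ) {t : ℕ}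
    {P : MvPolynomial (Fin (n + 2)) ℂ} (hP : P ∈ homogeneousSubmodule (Fin (n + 2)) ℂ t) :
    (aeval (diagonalSubst a)).toLinearMap P ∈ homogeneousSubmodule (Fin (n + 2)) ℂ t :=
  aeval_diagonalSubst_mem a hP

/-- **An ideal generated by eigenvectors of `P ↦ P(a • x)` is stable under it** (the substitution is a ring
endomorphism). [cite: SerreLinearRepresentations1977, §2.6 Thm. 8 (eigenspaces of a diagonal action)] -/
theorem aeval_diagonalSubst_mem_span_of_forall {ι : Type*} (a : Fin (n + 2) → ℂˣ)
    (G : ι → MvPolynomial (Fin (n + 2)) ℂ) (ε : ι → ℂ) (hG : ∀ i, aeval (diagonalSubst a) (G i) = ε i • G i)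
    {P : MvPolynomial (Fin (n + 2)) ℂ} (hP : P ∈ Ideal.span (Set.range G)) :
    (aeval (diagonalSubst a)).toLinearMap P ∈ Ideal.span (Set.range G) := by
  rw [AlgHom.toLinearMap_apply]
  refine Submodule.span_induction (p := fun P _ ↦ aeval (diagonalSubst a) P ∈ Ideal.span (Set.range G))
    ?_ ?_ ?_ ?_ hP
  · rintro _ ⟨i, rfl⟩
    rw [hG i]
    exact Submodule.smul_of_tower_mem _ (ε i) (Ideal.subset_span ⟨i, rfl⟩)
  · rw [map_zero]; exact Ideal.zero_mem _
  · intro x y _ _ hx hy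
    rw [map_add]; exact Ideal.add_mem _ hx hy
  · intro r x _ hx
    rw [smul_eq_mul, map_mul]; exact Ideal.mul_mem_left _ _ hx

/-- If an ideal is stable under `P ↦ P(a • x)` then so is each degree piece `I_t`. [cite: SerreLinearRepresentations1977, §2.6 Thm. 8 (eigenspaces of a diagonal action)] -/
theorem aeval_diagonalSubst_mem_idealDegree (a : Fin (n + 2) → ℂˣ) {I : Ideal (MvPolynomial (Fin (n + 2)) ℂ)}
    (hI : ∀ P ∈ I, (aeval (diagonalSubst a)).toLinearMap P ∈ I) {t : ℕ} {P : MvPolynomial (Fin (n + 2)) ℂ}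
    (hP : P ∈ idealDegree I t) : (aeval (diagonalSubst a)).toLinearMap P ∈ idealDegree I t :=
  ⟨hI P hP.1, aeval_diagonalSubst_mem a hP.2⟩

/-- The subspace `Q · S_t` is stable under `P ↦ P(a • x)` when `Q` is an eigenvector. [cite: SerreLinearRepresentations1977, §2.6 Thm. 8 (eigenspaces of a diagonal action)] -/
theorem aeval_diagonalSubst_mem_map_mulLeft (a : Fin (n + 2) → ℂˣ) {Q : MvPolynomial (Fin (n + 2)) ℂ} {ε : ℂ}
    (hQ : aeval (diagonalSubst a) Q = ε • Q) {t : ℕ} {P : MvPolynomial (Fin (n + 2)) ℂ}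
    (hP : P ∈ (homogeneousSubmodule (Fin (n + 2)) ℂ t).map (LinearMap.mulLeft ℂ Q)) :
    (aeval (diagonalSubst a)).toLinearMap P ∈ (homogeneousSubmodule (Fin (n + 2)) ℂ t).map (LinearMap.mulLeft ℂ Q) := by
  obtain ⟨r, hr, rfl⟩ := hP
  refine ⟨ε • aeval (diagonalSubst a) r, Submodule.smul_mem _ _ (aeval_diagonalSubst_mem a hr), ?_⟩
  rw [AlgHom.toLinearMap_apply, LinearMap.mulLeft_apply, LinearMap.mulLeft_apply, map_mul, hQ, smul_mul_assoc,
    mul_smul_comm]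

/-- `P ↦ P(a • x)` is `ε`-twisted equivariant for multiplication by an eigenvector `Q` (`Q(a • x) = εQ`):
`(QP)(a • x) = ε · Q · P(a • x)`. [cite: SerreLinearRepresentations1977, §2.6 Thm. 8 (eigenspaces of a diagonal action)] -/
theorem aeval_diagonalSubst_mulLeft (a : Fin (n + 2) → ℂˣ) {Q : MvPolynomial (Fin (n + 2)) ℂ} {ε : ℂ}
    (hQ : aeval (diagonalSubst a) Q = ε • Q) (P : MvPolynomial (Fin (n + 2)) ℂ) :
    (aeval (diagonalSubst a)).toLinearMap (LinearMap.mulLeft ℂ Q P) =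
      ε • LinearMap.mulLeft ℂ Q ((aeval (diagonalSubst a)).toLinearMap P) := by
  rw [AlgHom.toLinearMap_apply, AlgHom.toLinearMap_apply, LinearMap.mulLeft_apply, LinearMap.mulLeft_apply,
    map_mul, hQ, smul_mul_assoc]

end Subst

/-! ## §3 The sign-refined hypersurface section (Philippon's Lemme 3.1 on eigen-parts) -/

section Philippon

variable {n : ℕ}

/-- **Philippon's non-zero-divisor formula on the `±1`-parts of a sign symmetry.** Let `a` be a sign vector
(`a * a = 1`), `ι : P ↦ P(a • x)` the corresponding involution of `S = ℂ[x₀, …, x_{n+1}]`, `I` a homogeneous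
`ι`-stable ideal, `Q ≠ 0` a form of degree `q` with `ι Q = ε Q` (`ε = ±1`) which is a non-zero-divisor modulo
`I`. Then for `c = ±1`:
`dim ((I + (Q))_{t+q})_c + dim (I_t)_{cε} = dim (I_{t+q})_c + dim (S_t)_{cε}`, where `V_c = V ∩ E_c(ι)` — the
exact sequence `0 → (S/I)_t →·Q (S/I)_{t+q} → (S/(I,Q))_{t+q} → 0` restricted to eigen-parts (multiplication
by `Q` shifts the sign by `ε`). The tree's `finrank_idealDegree_sup_span_add_eq` is the unrefined statement.
[cite: Philippon1986, Lemme 3.1] [cite: CarlsonMullerStachPeters2017, §7.4 Thm. 7.4.1 (proof)] -/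
theorem finrank_idealDegree_sup_span_inf_eigenspace_add_eq {a : Fin (n + 2) → ℂˣ} (ha : a * a = 1)
    {I : Ideal (MvPolynomial (Fin (n + 2)) ℂ)} (hI : letI := MvPolynomial.gradedAlgebra (σ := Fin (n + 2)) (R := ℂ); I.IsHomogeneous (homogeneousSubmodule (Fin (n + 2)) ℂ))
    (hIι : ∀ P ∈ I, (aeval (diagonalSubst a)).toLinearMap P ∈ I) {Q : MvPolynomial (Fin (n + 2)) ℂ}
    (hQ0 : Q ≠ 0) {q : ℕ} (hQ : Q.IsHomogeneous q) {ε : ℂ} (hε : ε = 1 ∨ ε = -1)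
    (hQε : aeval (diagonalSubst a) Q = ε • Q) (hnzd : ∀ f, Q * f ∈ I → f ∈ I) {c : ℂ} (hc : c = 1 ∨ c = -1)
    (t : ℕ) :
    finrank ℂ ↥(idealDegree (I ⊔ Ideal.span {Q}) (t + q) ⊓ Module.End.eigenspace (aeval (diagonalSubst a)).toLinearMap c) +
      finrank ℂ ↥(idealDegree I t ⊓ Module.End.eigenspace (aeval (diagonalSubst a)).toLinearMap (c * ε)) =
      finrank ℂ ↥(idealDegree I (t + q) ⊓ Module.End.eigenspace (aeval (diagonalSubst a)).toLinearMap c) +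
        finrank ℂ ↥(homogeneousSubmodule (Fin (n + 2)) ℂ t ⊓
          Module.End.eigenspace (aeval (diagonalSubst a)).toLinearMap (c * ε)) := by
  have hι : ∀ P, (aeval (diagonalSubst a)).toLinearMap ((aeval (diagonalSubst a)).toLinearMap P) = P :=
    aeval_diagonalSubst_aeval_diagonalSubst_self ha
  haveI := finite_homogeneousSubmodule (K := ℂ) (σ := Fin (n + 2)) t
  haveI := finite_homogeneousSubmodule (K := ℂ) (σ := Fin (n + 2)) (t + q)
  haveI : FiniteDimensional ℂ ↥(idealDegree I (t + q)) :=
    Submodule.finiteDimensional_of_le (idealDegree_le_homogeneousSubmodule I (t + q))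
  haveI : FiniteDimensional ℂ ↥(idealDegree I t) :=
    Submodule.finiteDimensional_of_le (idealDegree_le_homogeneousSubmodule I t)
  -- the two eigen-parts whose sup / inf are computed
  set A := idealDegree I (t + q) ⊓ Module.End.eigenspace (aeval (diagonalSubst a)).toLinearMap c with hA
  set B := (homogeneousSubmodule (Fin (n + 2)) ℂ t).map (LinearMap.mulLeft ℂ Q) ⊓
    Module.End.eigenspace (aeval (diagonalSubst a)).toLinearMap c with hB
  haveI : FiniteDimensional ℂ ↥A := Submodule.finiteDimensional_of_le inf_le_left
  haveI : FiniteDimensional ℂ ↥((homogeneousSubmodule (Fin (n + 2)) ℂ t).map (LinearMap.mulLeft ℂ Q)) :=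
    Module.Finite.map _ _
  haveI : FiniteDimensional ℂ ↥B := Submodule.finiteDimensional_of_le inf_le_left
  have h1 := Submodule.finrank_sup_add_finrank_inf_eq A B
  -- `A ⊔ B = ((I + (Q))_{t+q})_c`
  have hsup : A ⊔ B = idealDegree (I ⊔ Ideal.span {Q}) (t + q) ⊓
      Module.End.eigenspace (aeval (diagonalSubst a)).toLinearMap c := by
    rw [hA, hB, ← sup_inf_eigenspace_eq hι (fun P hP ↦ aeval_diagonalSubst_mem_idealDegree a hIι hP)
      (fun P hP ↦ aeval_diagonalSubst_mem_map_mulLeft a hQε hP) hc, ← idealDegree_sup_span_singleton hI hQ t]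
  -- `A ⊓ B = Q · (I_t)_{cε}`
  have hcomm : ∀ y, (aeval (diagonalSubst a)).toLinearMap (LinearMap.mulLeft ℂ Q y) =
      ε • LinearMap.mulLeft ℂ Q ((aeval (diagonalSubst a)).toLinearMap y) := aeval_diagonalSubst_mulLeft a hQε
  have hinj : Function.Injective (LinearMap.mulLeft ℂ Q) := mul_right_injective₀ hQ0
  have hinf : A ⊓ B = (idealDegree I t ⊓
      Module.End.eigenspace (aeval (diagonalSubst a)).toLinearMap (c * ε)).map (LinearMap.mulLeft ℂ Q) := by
    rw [hA, hB, inf_inf_inf_comm, inf_idem, idealDegree_inf_map_mulLeft_eq hQ hnzd t,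
      map_inf_eigenspace_eq _ hinj hε hcomm]
  have hB' : B = (homogeneousSubmodule (Fin (n + 2)) ℂ t ⊓
      Module.End.eigenspace (aeval (diagonalSubst a)).toLinearMap (c * ε)).map (LinearMap.mulLeft ℂ Q) := by
    rw [hB, map_inf_eigenspace_eq _ hinj hε hcomm]
  haveI : FiniteDimensional ℂ ↥(idealDegree I t ⊓
      Module.End.eigenspace (aeval (diagonalSubst a)).toLinearMap (c * ε)) :=
    Submodule.finiteDimensional_of_le inf_le_left
  haveI : FiniteDimensional ℂ ↥(homogeneousSubmodule (Fin (n + 2)) ℂ t ⊓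
      Module.End.eigenspace (aeval (diagonalSubst a)).toLinearMap (c * ε)) :=
    Submodule.finiteDimensional_of_le inf_le_left
  rw [hsup, hinf, finrank_map_mulLeft hQ0] at h1
  rw [hB', finrank_map_mulLeft hQ0] at h1
  omega

end Philippon

/-! ## §4 The sign-refined Hilbert function of `(G_0, …, G_{k−1})` depends only on degrees and signs -/

section Comparison

variable {n : ℕ}

/-- `I_{n+2} = (G_0, …, G_{n+1})` as the span of the range. [cite: CarlsonMullerStachPeters2017, §7.4 Thm. 7.4.1 (proof)] -/
theorem ofList_take_card_eq_span (G : Fin (n + 2) → MvPolynomial (Fin (n + 2)) ℂ) :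
    Ideal.ofList ((List.ofFn G).take (n + 2)) = Ideal.span (Set.range G) := by
  rw [List.take_of_length_le (by simp), Ideal.ofList]
  congr 1
  ext z
  rw [Set.mem_setOf_eq, List.mem_ofFn', Set.mem_range]

/-- `I_{k+1} = I_k + (G_k)`. [cite: CarlsonMullerStachPeters2017, §7.4 Thm. 7.4.1 (proof)] -/
theorem ofList_take_succ' (G : Fin (n + 2) → MvPolynomial (Fin (n + 2)) ℂ) {k : ℕ} (hk : k < n + 2) :
    Ideal.ofList ((List.ofFn G).take (k + 1)) =
      Ideal.ofList ((List.ofFn G).take k) ⊔ Ideal.span {G ⟨k, hk⟩} := by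
  rw [List.take_succ_eq_append_getElem (by simp; omega), Ideal.ofList_append, Ideal.ofList_singleton,
    List.getElem_ofFn]

/-- `I_k` is a homogeneous ideal. [cite: CarlsonMullerStachPeters2017, §7.4 Thm. 7.4.1 (proof)] -/
theorem isHomogeneous_ofList_take' {G : Fin (n + 2) → MvPolynomial (Fin (n + 2)) ℂ} {d : Fin (n + 2) → ℕ}
    (hG : ∀ i, (G i).IsHomogeneous (d i)) (k : ℕ) :
    letI := MvPolynomial.gradedAlgebra (σ := Fin (n + 2)) (R := ℂ)
    (Ideal.ofList ((List.ofFn G).take k)).IsHomogeneous (homogeneousSubmodule (Fin (n + 2)) ℂ) := by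
  letI := MvPolynomial.gradedAlgebra (σ := Fin (n + 2)) (R := ℂ)
  refine Ideal.homogeneous_span _ _ fun x hx => ?_
  obtain ⟨i, rfl⟩ := (List.mem_ofFn' G x).mp (List.mem_of_mem_take hx)
  exact ⟨d i, hG i⟩

/-- `I_k` is stable under `P ↦ P(a • x)` when the `G_i` are eigenvectors. [cite: CarlsonMullerStachPeters2017, §7.4 Thm. 7.4.1 (proof)] -/
theorem aeval_diagonalSubst_mem_ofList_take (a : Fin (n + 2) → ℂˣ) {G : Fin (n + 2) → MvPolynomial (Fin (n + 2)) ℂ}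
    {ε : Fin (n + 2) → ℂ} (hGε : ∀ i, aeval (diagonalSubst a) (G i) = ε i • G i) (k : ℕ)
    {P : MvPolynomial (Fin (n + 2)) ℂ} (hP : P ∈ Ideal.ofList ((List.ofFn G).take k)) :
    (aeval (diagonalSubst a)).toLinearMap P ∈ Ideal.ofList ((List.ofFn G).take k) := by
  rw [AlgHom.toLinearMap_apply]
  refine Submodule.span_induction (p := fun P _ ↦ aeval (diagonalSubst a) P ∈ Ideal.ofList ((List.ofFn G).take k))
    ?_ ?_ ?_ ?_ hP
  · intro x hx
    obtain ⟨i, rfl⟩ := (List.mem_ofFn' G x).mp (List.mem_of_mem_take hx)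
    rw [hGε i]
    exact Submodule.smul_of_tower_mem _ (ε i) (Ideal.subset_span hx)
  · rw [map_zero]; exact Ideal.zero_mem _
  · intro x y _ _ hx hy
    rw [map_add]; exact Ideal.add_mem _ hx hy
  · intro r x _ hx
    rw [smul_eq_mul, map_mul]; exact Ideal.mul_mem_left _ _ hx

/-- Below the degree of a new generator nothing changes: `(I + (Q))_t = I_t` for `t < deg Q`. [cite: CarlsonMullerStachPeters2017, §7.4 Thm. 7.4.1 (proof)] -/
theorem idealDegree_sup_span_singleton_eq_of_lt {I : Ideal (MvPolynomial (Fin (n + 2)) ℂ)}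
    (hI : letI := MvPolynomial.gradedAlgebra (σ := Fin (n + 2)) (R := ℂ); I.IsHomogeneous (homogeneousSubmodule (Fin (n + 2)) ℂ)) {Q : MvPolynomial (Fin (n + 2)) ℂ} {q t : ℕ}
    (hQ : Q.IsHomogeneous q) (ht : t < q) : idealDegree (I ⊔ Ideal.span {Q}) t = idealDegree I t := by
  refine le_antisymm ?_ (idealDegree_mono le_sup_left t)
  rintro f ⟨hf, hft⟩
  obtain ⟨i, hi, j, hj, rfl⟩ := Submodule.mem_sup.mp hf
  obtain ⟨r, rfl⟩ := Ideal.mem_span_singleton'.mp hj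
  refine ⟨?_, hft⟩
  have hzero : homogeneousComponent t (r * Q) = 0 := by
    rw [← sum_homogeneousComponent r, Finset.sum_mul, map_sum]
    refine Finset.sum_eq_zero fun k _ ↦ ?_
    rw [homogeneousComponent_of_mem ((homogeneousComponent_isHomogeneous k r).mul hQ), if_neg (by omega)]
  rw [← homogeneousComponent_eq_self hft, map_add, hzero, add_zero]
  exact homogeneousComponent_mem_of_mem hI hi t

/-- The generators are non-zero when the quotient is finite (`1 ∉ (G)`: forms of positive degree have no
constant term). [cite: CarlsonMullerStachPeters2017, §7.4 Thm. 7.4.1 (proof)] -/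
theorem ne_zero_of_X_pow_mem' (G : Fin (n + 2) → MvPolynomial (Fin (n + 2)) ℂ) (d : Fin (n + 2) → ℕ)
    (hG : ∀ i, (G i).IsHomogeneous (d i)) (hd : ∀ i, 0 < d i) {N : ℕ}
    (hXN : ∀ i, (X i : MvPolynomial (Fin (n + 2)) ℂ) ^ N ∈ Ideal.span (Set.range G)) (k : Fin (n + 2)) :
    G k ≠ 0 := by
  intro h0
  have h1 : (1 : MvPolynomial (Fin (n + 2)) ℂ) ∈ Ideal.ofList ((List.ofFn G).take k) :=
    mem_ofList_take_of_mul_mem G d hG hd hXN k.2 (u := 1) (by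
      rw [show (⟨(k : ℕ), k.2⟩ : Fin (n + 2)) = k from rfl, h0, zero_mul]; exact Ideal.zero_mem _)
  -- every generator has zero constant coefficient, hence so does `1`: contradiction
  have hker : Ideal.ofList ((List.ofFn G).take k) ≤ RingHom.ker (constantCoeff (R := ℂ) (σ := Fin (n + 2))) := by
    refine Ideal.span_le.mpr fun x hx ↦ ?_
    obtain ⟨i, rfl⟩ := (List.mem_ofFn' G x).mp (List.mem_of_mem_take hx)
    rw [SetLike.mem_coe, RingHom.mem_ker]
    exact (hG i).coeff_eq_zero (by simpa using (hd i).ne)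
  have := hker h1
  rw [RingHom.mem_ker, map_one] at this
  exact one_ne_zero this

/-- **The sign-refined Hilbert function of `(G_0, …, G_{k−1})` depends only on the degrees and the signs**:
for two families of `n + 2` forms `G`, `G'` with finite quotients, the same degrees `d_i > 0` and the same
eigenvalues under `P ↦ P(a • x)` (`a` a sign vector), `dim (S_t)_c − dim ((I_k)_t)_c` agree for every `k ≤ n+2`,
`t`, `c = ±1` (induction on `k` through §3). [cite: Philippon1986, Lemme 3.1]
[cite: CarlsonMullerStachPeters2017, §7.4 Thm. 7.4.1 (proof)] -/
theorem hilbertSign_ofList_take_eq_of_X_pow_mem {a : Fin (n + 2) → ℂˣ} (ha : a * a = 1)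
    (G G' : Fin (n + 2) → MvPolynomial (Fin (n + 2)) ℂ) (d : Fin (n + 2) → ℕ) (ε : Fin (n + 2) → ℂ)
    (hG : ∀ i, (G i).IsHomogeneous (d i)) (hG' : ∀ i, (G' i).IsHomogeneous (d i)) (hd : ∀ i, 0 < d i)
    (hε : ∀ i, ε i = 1 ∨ ε i = -1) (hGε : ∀ i, aeval (diagonalSubst a) (G i) = ε i • G i)
    (hG'ε : ∀ i, aeval (diagonalSubst a) (G' i) = ε i • G' i) {N N' : ℕ}
    (hXN : ∀ i, (X i : MvPolynomial (Fin (n + 2)) ℂ) ^ N ∈ Ideal.span (Set.range G))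
    (hXN' : ∀ i, (X i : MvPolynomial (Fin (n + 2)) ℂ) ^ N' ∈ Ideal.span (Set.range G')) :
    ∀ k, k ≤ n + 2 → ∀ (t : ℕ) (c : ℂ), (c = 1 ∨ c = -1) →
      finrank ℂ ↥(homogeneousSubmodule (Fin (n + 2)) ℂ t ⊓ Module.End.eigenspace (aeval (diagonalSubst a)).toLinearMap c) -
          finrank ℂ ↥(idealDegree (Ideal.ofList ((List.ofFn G).take k)) t ⊓
            Module.End.eigenspace (aeval (diagonalSubst a)).toLinearMap c) =
        finrank ℂ ↥(homogeneousSubmodule (Fin (n + 2)) ℂ t ⊓ Module.End.eigenspace (aeval (diagonalSubst a)).toLinearMap c) -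
          finrank ℂ ↥(idealDegree (Ideal.ofList ((List.ofFn G').take k)) t ⊓
            Module.End.eigenspace (aeval (diagonalSubst a)).toLinearMap c) := by
  -- `dim (I_t)_c ≤ dim (S_t)_c`
  have hle : ∀ (I : Ideal (MvPolynomial (Fin (n + 2)) ℂ)) (t : ℕ) (c : ℂ),
      finrank ℂ ↥(idealDegree I t ⊓ Module.End.eigenspace (aeval (diagonalSubst a)).toLinearMap c) ≤
        finrank ℂ ↥(homogeneousSubmodule (Fin (n + 2)) ℂ t ⊓
          Module.End.eigenspace (aeval (diagonalSubst a)).toLinearMap c) := by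
    intro I t c
    haveI := finite_homogeneousSubmodule (K := ℂ) (σ := Fin (n + 2)) t
    haveI : FiniteDimensional ℂ ↥(homogeneousSubmodule (Fin (n + 2)) ℂ t ⊓
        Module.End.eigenspace (aeval (diagonalSubst a)).toLinearMap c) :=
      Submodule.finiteDimensional_of_le inf_le_left
    exact Submodule.finrank_mono (inf_le_inf_right _ (idealDegree_le_homogeneousSubmodule I t))
  intro k
  induction k with
  | zero => intro _ t c _; rfl
  | succ k ih =>
    intro hk t c hc
    have hk' : k < n + 2 := by omega
    rw [ofList_take_succ' G hk', ofList_take_succ' G' hk']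
    by_cases ht : t < d ⟨k, hk'⟩
    · rw [idealDegree_sup_span_singleton_eq_of_lt (isHomogeneous_ofList_take' hG k) (hG ⟨k, hk'⟩) ht,
        idealDegree_sup_span_singleton_eq_of_lt (isHomogeneous_ofList_take' hG' k) (hG' ⟨k, hk'⟩) ht]
      exact ih hk'.le t c hc
    · obtain ⟨t', rfl⟩ : ∃ t', t = t' + d ⟨k, hk'⟩ := ⟨t - d ⟨k, hk'⟩, by omega⟩
      have hcε : c * ε ⟨k, hk'⟩ = 1 ∨ c * ε ⟨k, hk'⟩ = -1 := by
        rcases hc with rfl | rfl <;> rcases hε ⟨k, hk'⟩ with h | h <;> simp [h]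
      have h1 := finrank_idealDegree_sup_span_inf_eigenspace_add_eq ha (isHomogeneous_ofList_take' hG k)
        (fun P hP ↦ aeval_diagonalSubst_mem_ofList_take a hGε k hP)
        (ne_zero_of_X_pow_mem' G d hG hd hXN ⟨k, hk'⟩) (hG ⟨k, hk'⟩) (hε ⟨k, hk'⟩) (hGε ⟨k, hk'⟩)
        (fun f hf ↦ mem_ofList_take_of_mul_mem G d hG hd hXN hk' hf) hc t'
      have h2 := finrank_idealDegree_sup_span_inf_eigenspace_add_eq ha (isHomogeneous_ofList_take' hG' k)
        (fun P hP ↦ aeval_diagonalSubst_mem_ofList_take a hG'ε k hP)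
        (ne_zero_of_X_pow_mem' G' d hG' hd hXN' ⟨k, hk'⟩) (hG' ⟨k, hk'⟩) (hε ⟨k, hk'⟩) (hG'ε ⟨k, hk'⟩)
        (fun f hf ↦ mem_ofList_take_of_mul_mem G' d hG' hd hXN' hk' hf) hc t'
      have h3 := ih hk'.le t' (c * ε ⟨k, hk'⟩) hcε
      have h4 := ih hk'.le (t' + d ⟨k, hk'⟩) c hc
      have h5 := hle (Ideal.ofList ((List.ofFn G).take k)) t' (c * ε ⟨k, hk'⟩)
      have h6 := hle (Ideal.ofList ((List.ofFn G').take k)) t' (c * ε ⟨k, hk'⟩)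
      have h7 := hle (Ideal.ofList ((List.ofFn G).take k)) (t' + d ⟨k, hk'⟩) c
      have h8 := hle (Ideal.ofList ((List.ofFn G').take k)) (t' + d ⟨k, hk'⟩) c
      have h9 := hle (Ideal.ofList ((List.ofFn G).take k) ⊔ Ideal.span {G ⟨k, hk'⟩}) (t' + d ⟨k, hk'⟩) c
      have h10 := hle (Ideal.ofList ((List.ofFn G').take k) ⊔ Ideal.span {G' ⟨k, hk'⟩}) (t' + d ⟨k, hk'⟩) c
      omega

/-- **The sign-refined Hilbert function of an Artinian complete intersection of eigenforms depends only on the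
degrees and the signs** (`k = n + 2` of the previous theorem). [cite: CarlsonMullerStachPeters2017, §7.4 Thm. 7.4.1 (proof)]
[cite: Philippon1986, Lemme 3.1] -/
theorem hilbertSign_span_eq_of_X_pow_mem {a : Fin (n + 2) → ℂˣ} (ha : a * a = 1)
    (G G' : Fin (n + 2) → MvPolynomial (Fin (n + 2)) ℂ) (d : Fin (n + 2) → ℕ) (ε : Fin (n + 2) → ℂ)
    (hG : ∀ i, (G i).IsHomogeneous (d i)) (hG' : ∀ i, (G' i).IsHomogeneous (d i)) (hd : ∀ i, 0 < d i)
    (hε : ∀ i, ε i = 1 ∨ ε i = -1) (hGε : ∀ i, aeval (diagonalSubst a) (G i) = ε i • G i)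
    (hG'ε : ∀ i, aeval (diagonalSubst a) (G' i) = ε i • G' i) {N N' : ℕ}
    (hXN : ∀ i, (X i : MvPolynomial (Fin (n + 2)) ℂ) ^ N ∈ Ideal.span (Set.range G))
    (hXN' : ∀ i, (X i : MvPolynomial (Fin (n + 2)) ℂ) ^ N' ∈ Ideal.span (Set.range G')) (t : ℕ) {c : ℂ}
    (hc : c = 1 ∨ c = -1) :
    finrank ℂ ↥(homogeneousSubmodule (Fin (n + 2)) ℂ t ⊓ Module.End.eigenspace (aeval (diagonalSubst a)).toLinearMap c) -
        finrank ℂ ↥(idealDegree (Ideal.span (Set.range G)) t ⊓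
          Module.End.eigenspace (aeval (diagonalSubst a)).toLinearMap c) =
      finrank ℂ ↥(homogeneousSubmodule (Fin (n + 2)) ℂ t ⊓ Module.End.eigenspace (aeval (diagonalSubst a)).toLinearMap c) -
        finrank ℂ ↥(idealDegree (Ideal.span (Set.range G')) t ⊓
          Module.End.eigenspace (aeval (diagonalSubst a)).toLinearMap c) := by
  have h := hilbertSign_ofList_take_eq_of_X_pow_mem ha G G' d ε hG hG' hd hε hGε hG'ε hXN hXN' (n + 2) le_rfl t c hc
  rwa [ofList_take_card_eq_span G, ofList_take_card_eq_span G'] at h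

end Comparison

/-! ## §5 Counting: eigen-parts of `S_t` and of the degree pieces of a monomial complete intersection -/

section Count

variable {n : ℕ}

/-- Membership in `univ.finsuppAntidiag t` is having degree `t`. [cite: Movasati2016Periods, Definition 1 and §6] -/
theorem mem_finsuppAntidiag_univ_iff_degree {β : Fin (n + 2) →₀ ℕ} {t : ℕ} :
    β ∈ (Finset.univ : Finset (Fin (n + 2))).finsuppAntidiag t ↔ β.degree = t := by
  classical
  simp [Finset.mem_finsuppAntidiag, Finsupp.degree_eq_sum]

/-- `S_t` is the space of polynomials supported on the exponents of degree `t`. [cite: Movasati2016Periods, Definition 1 and §6] -/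
theorem mem_homogeneousSubmodule_iff_support_subset {t : ℕ} {P : MvPolynomial (Fin (n + 2)) ℂ} :
    P ∈ homogeneousSubmodule (Fin (n + 2)) ℂ t ↔ ∀ β ∈ P.support, β.degree = t := by
  have e : ∀ β : Fin (n + 2) →₀ ℕ, Finsupp.weight (1 : Fin (n + 2) → ℕ) β = β.degree := fun β ↦ by
    rw [Finsupp.degree_eq_weight_one]; rfl
  rw [mem_homogeneousSubmodule]
  refine ⟨fun h β hβ ↦ ?_, fun h β hβ ↦ ?_⟩
  · rw [← e]; exact h (mem_support_iff.mp hβ)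
  · rw [e]; exact h β (mem_support_iff.mpr hβ)

/-- The dimension of a space of polynomials with prescribed (finite) support set is its size. [cite: Movasati2016Periods, Definition 1 and §6] -/
theorem finrank_restrictSupport_coe (T : Finset (Fin (n + 2) →₀ ℕ)) :
    finrank ℂ ↥(restrictSupport ℂ (↑T : Set (Fin (n + 2) →₀ ℕ))) = T.card := by
  rw [Module.finrank_eq_card_basis (basisRestrictSupport ℂ (↑T : Set (Fin (n + 2) →₀ ℕ)))]
  simp

/-- **`dim (S_t)_c = #{β : |β| = t, a^β = c}`** (the monomials are an eigenbasis of `P ↦ P(a • x)`). [cite: Movasati2016Periods, Definition 1 and §6] -/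
theorem finrank_homogeneousSubmodule_inf_eigenspace (a : Fin (n + 2) → ℂˣ) (c : ℂ) (t : ℕ) :
    finrank ℂ ↥(homogeneousSubmodule (Fin (n + 2)) ℂ t ⊓ Module.End.eigenspace (aeval (diagonalSubst a)).toLinearMap c) =
      (((Finset.univ : Finset (Fin (n + 2))).finsuppAntidiag t).filter
        fun β : Fin (n + 2) →₀ ℕ ↦ (∏ i, ((a i : ℂˣ) : ℂ) ^ β i) = c).card := by
  classical
  rw [← finrank_restrictSupport_coe]
  have hS : homogeneousSubmodule (Fin (n + 2)) ℂ t ⊓ Module.End.eigenspace (aeval (diagonalSubst a)).toLinearMap c =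
      restrictSupport ℂ (↑(((Finset.univ : Finset (Fin (n + 2))).finsuppAntidiag t).filter
        fun β : Fin (n + 2) →₀ ℕ ↦ (∏ i, ((a i : ℂˣ) : ℂ) ^ β i) = c) : Set (Fin (n + 2) →₀ ℕ)) := by
    ext P
    rw [Submodule.mem_inf, mem_homogeneousSubmodule_iff_support_subset, mem_eigenspace_aeval_diagonalSubst_iff,
      mem_restrictSupport_iff]
    simp only [Finset.coe_filter, Set.subset_def, Finset.mem_coe, Set.mem_setOf_eq,
      mem_finsuppAntidiag_univ_iff_degree]
    exact ⟨fun h β hβ ↦ ⟨h.1 β hβ, h.2 β hβ⟩, fun h ↦ ⟨fun β hβ ↦ (h β hβ).1, fun β hβ ↦ (h β hβ).2⟩⟩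
  rw [hS]

/-- Membership in the monomial complete intersection `(x_0^{e_0}, …, x_{n+1}^{e_{n+1}})`: every monomial of the
support is divisible by some `x_i^{e_i}`. [cite: Movasati2016Periods, Definition 1 and §6] -/
theorem mem_span_X_pow_iff (e : Fin (n + 2) → ℕ) (P : MvPolynomial (Fin (n + 2)) ℂ) :
    P ∈ Ideal.span (Set.range fun i : Fin (n + 2) ↦ (X i : MvPolynomial (Fin (n + 2)) ℂ) ^ e i) ↔
      ∀ β ∈ P.support, ∃ i, e i ≤ β i := by
  have hset : Set.range (fun i : Fin (n + 2) ↦ (X i : MvPolynomial (Fin (n + 2)) ℂ) ^ e i) =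
      (fun s ↦ monomial s (1 : ℂ)) '' Set.range (fun i : Fin (n + 2) ↦ Finsupp.single i (e i)) := by
    ext P
    simp only [Set.mem_range, Set.mem_image, exists_exists_eq_and, X_pow_eq_monomial]
  rw [hset, mem_ideal_span_monomial_image]
  refine forall₂_congr fun β _ ↦ ⟨?_, ?_⟩
  · rintro ⟨_, ⟨i, rfl⟩, hle⟩
    exact ⟨i, Finsupp.single_le_iff.mp hle⟩
  · rintro ⟨i, hi⟩
    exact ⟨_, ⟨i, rfl⟩, Finsupp.single_le_iff.mpr hi⟩

/-- **`dim ((x^e)_t)_c = #{β : |β| = t, ∃ i, e_i ≤ β_i, a^β = c}`** for the monomial complete intersection. [cite: Movasati2016Periods, Definition 1 and §6] -/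
theorem finrank_idealDegree_span_X_pow_inf_eigenspace (a : Fin (n + 2) → ℂˣ) (e : Fin (n + 2) → ℕ) (c : ℂ) (t : ℕ) :
    finrank ℂ ↥(idealDegree (Ideal.span (Set.range fun i : Fin (n + 2) ↦ (X i : MvPolynomial (Fin (n + 2)) ℂ) ^ e i)) t ⊓
        Module.End.eigenspace (aeval (diagonalSubst a)).toLinearMap c) =
      (((Finset.univ : Finset (Fin (n + 2))).finsuppAntidiag t).filter
        fun β : Fin (n + 2) →₀ ℕ ↦ (∃ i, e i ≤ β i) ∧ (∏ i, ((a i : ℂˣ) : ℂ) ^ β i) = c).card := by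
  classical
  rw [← finrank_restrictSupport_coe]
  have hS : idealDegree (Ideal.span (Set.range fun i : Fin (n + 2) ↦ (X i : MvPolynomial (Fin (n + 2)) ℂ) ^ e i)) t ⊓
        Module.End.eigenspace (aeval (diagonalSubst a)).toLinearMap c =
      restrictSupport ℂ (↑(((Finset.univ : Finset (Fin (n + 2))).finsuppAntidiag t).filter
        fun β : Fin (n + 2) →₀ ℕ ↦ (∃ i, e i ≤ β i) ∧ (∏ i, ((a i : ℂˣ) : ℂ) ^ β i) = c) :
          Set (Fin (n + 2) →₀ ℕ)) := by
    ext P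
    rw [Submodule.mem_inf, mem_idealDegree, mem_span_X_pow_iff, ← mem_homogeneousSubmodule,
      mem_homogeneousSubmodule_iff_support_subset, mem_eigenspace_aeval_diagonalSubst_iff, mem_restrictSupport_iff]
    simp only [Finset.coe_filter, Set.subset_def, Finset.mem_coe, Set.mem_setOf_eq,
      mem_finsuppAntidiag_univ_iff_degree]
    exact ⟨fun h β hβ ↦ ⟨h.1.2 β hβ, h.1.1 β hβ, h.2 β hβ⟩,
      fun h ↦ ⟨⟨fun β hβ ↦ (h β hβ).2.1, fun β hβ ↦ (h β hβ).1⟩, fun β hβ ↦ (h β hβ).2.2⟩⟩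
  rw [hS]

/-- **The sign-refined Hilbert function of the monomial complete intersection `(x_i^{e_i})`** is the refined box
count `#{β : |β| = t, β_i ≤ e_i − 1, a^β = c}`. [cite: Movasati2016Periods, §6] [cite: Kloosterman2023, §2 eq. (1)] -/
theorem hilbertSign_span_X_pow_eq_card (a : Fin (n + 2) → ℂˣ) (e : Fin (n + 2) → ℕ) (he : ∀ i, 0 < e i) (c : ℂ)
    (t : ℕ) :
    finrank ℂ ↥(homogeneousSubmodule (Fin (n + 2)) ℂ t ⊓ Module.End.eigenspace (aeval (diagonalSubst a)).toLinearMap c) -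
        finrank ℂ ↥(idealDegree (Ideal.span (Set.range fun i : Fin (n + 2) ↦ (X i : MvPolynomial (Fin (n + 2)) ℂ) ^ e i)) t ⊓
          Module.End.eigenspace (aeval (diagonalSubst a)).toLinearMap c) =
      (((Finset.univ : Finset (Fin (n + 2))).finsuppAntidiag t).filter
        fun β : Fin (n + 2) →₀ ℕ ↦ (∀ i, β i ≤ e i - 1) ∧ (∏ i, ((a i : ℂˣ) : ℂ) ^ β i) = c).card := by
  classical
  rw [finrank_homogeneousSubmodule_inf_eigenspace, finrank_idealDegree_span_X_pow_inf_eigenspace]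
  set A := ((Finset.univ : Finset (Fin (n + 2))).finsuppAntidiag t).filter
    fun β : Fin (n + 2) →₀ ℕ ↦ (∏ i, ((a i : ℂˣ) : ℂ) ^ β i) = c with hA
  have hsplit := Finset.card_filter_add_card_filter_not (s := A) (fun β : Fin (n + 2) →₀ ℕ ↦ ∃ i, e i ≤ β i)
  have h1 : A.filter (fun β : Fin (n + 2) →₀ ℕ ↦ ∃ i, e i ≤ β i) =
      ((Finset.univ : Finset (Fin (n + 2))).finsuppAntidiag t).filter
        fun β : Fin (n + 2) →₀ ℕ ↦ (∃ i, e i ≤ β i) ∧ (∏ i, ((a i : ℂˣ) : ℂ) ^ β i) = c := by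
    rw [hA, Finset.filter_filter]
    exact Finset.filter_congr fun β _ ↦ and_comm
  have h2 : A.filter (fun β : Fin (n + 2) →₀ ℕ ↦ ¬ ∃ i, e i ≤ β i) =
      ((Finset.univ : Finset (Fin (n + 2))).finsuppAntidiag t).filter
        fun β : Fin (n + 2) →₀ ℕ ↦ (∀ i, β i ≤ e i - 1) ∧ (∏ i, ((a i : ℂˣ) : ℂ) ^ β i) = c := by
    rw [hA, Finset.filter_filter]
    refine Finset.filter_congr fun β _ ↦ ?_
    rw [and_comm, not_exists]
    exact and_congr_left fun _ ↦ forall_congr' fun i ↦ by have := he i; omega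
  rw [h1, h2] at hsplit
  omega

end Count

/-! ## §6 Artinian complete intersections of eigenforms -/

section Artinian

variable {n : ℕ}

/-- `x_i^{e}` is an eigenvector of `P ↦ P(a • x)` with eigenvalue `a_i^{e}`. [cite: VoisinHodgeII2003, §6.2.2 Def. 6.18 (held text chunk p0165)] -/
theorem aeval_diagonalSubst_X_pow (a : Fin (n + 2) → ℂˣ) (i : Fin (n + 2)) (e : ℕ) :
    aeval (diagonalSubst a) ((X i : MvPolynomial (Fin (n + 2)) ℂ) ^ e) =
      (((a i : ℂˣ) : ℂ) ^ e) • ((X i : MvPolynomial (Fin (n + 2)) ℂ) ^ e) := by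
  rw [map_pow, aeval_X, diagonalSubst_apply, mul_pow, ← C_pow, Algebra.smul_def, algebraMap_eq]

/-- **The sign-refined Hilbert function of an Artinian complete intersection of eigenforms is the refined box
count.** For a sign vector `a`, `n + 2` forms `G_i` of degrees `d_i > 0` with `G_i(a • x) = a_i^{d_i} G_i`
and a power of every variable in `(G)`: `dim (S_t)_c − dim ((G)_t)_c = #{β : |β| = t, β_i ≤ d_i − 1, a^β = c}`
for `c = ±1` (comparison with `(x_i^{d_i})`, §4–§5). [cite: CarlsonMullerStachPeters2017, §7.4 Thm. 7.4.1 (proof)]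
[cite: Kloosterman2023, §2 eq. (1)] -/
theorem hilbertSign_span_eq_card_of_degrees {a : Fin (n + 2) → ℂˣ} (ha : a * a = 1)
    (G : Fin (n + 2) → MvPolynomial (Fin (n + 2)) ℂ) (d : Fin (n + 2) → ℕ) (hG : ∀ i, (G i).IsHomogeneous (d i))
    (hd : ∀ i, 0 < d i) (hGε : ∀ i, aeval (diagonalSubst a) (G i) = (((a i : ℂˣ) : ℂ) ^ d i) • G i) {N : ℕ}
    (hXN : ∀ i, (X i : MvPolynomial (Fin (n + 2)) ℂ) ^ N ∈ Ideal.span (Set.range G)) {c : ℂ} (hc : c = 1 ∨ c = -1)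
    (t : ℕ) :
    finrank ℂ ↥(homogeneousSubmodule (Fin (n + 2)) ℂ t ⊓ Module.End.eigenspace (aeval (diagonalSubst a)).toLinearMap c) -
        finrank ℂ ↥(idealDegree (Ideal.span (Set.range G)) t ⊓
          Module.End.eigenspace (aeval (diagonalSubst a)).toLinearMap c) =
      (((Finset.univ : Finset (Fin (n + 2))).finsuppAntidiag t).filter
        fun β : Fin (n + 2) →₀ ℕ ↦ (∀ i, β i ≤ d i - 1) ∧ (∏ i, ((a i : ℂˣ) : ℂ) ^ β i) = c).card := by
  have hai : ∀ i, ((a i : ℂˣ) : ℂ) = 1 ∨ ((a i : ℂˣ) : ℂ) = -1 := by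
    intro i
    have h := congrFun ha i
    rw [Pi.mul_apply, Pi.one_apply, ← Units.val_eq_one, Units.val_mul] at h
    exact mul_self_eq_one_iff.mp h
  have hε : ∀ i, ((a i : ℂˣ) : ℂ) ^ d i = 1 ∨ ((a i : ℂˣ) : ℂ) ^ d i = -1 := by
    intro i
    rcases hai i with h | h
    · left; rw [h, one_pow]
    · rw [h]; exact (neg_one_pow_eq_or ℂ (d i))
  have h1 := hilbertSign_span_eq_of_X_pow_mem ha G (fun i ↦ X i ^ d i) d (fun i ↦ ((a i : ℂˣ) : ℂ) ^ d i) hG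
    (fun i ↦ isHomogeneous_X_pow i (d i)) hd hε hGε (fun i ↦ aeval_diagonalSubst_X_pow a i (d i)) hXN
    (N' := ∑ j, d j) (fun i ↦ (Ideal.span _).pow_mem_of_pow_mem (Ideal.subset_span ⟨i, rfl⟩)
      (Finset.single_le_sum (f := d) (fun j _ ↦ Nat.zero_le _) (Finset.mem_univ i))) t hc
  rw [h1]
  exact hilbertSign_span_X_pow_eq_card a d hd c t

end Artinian

/-! ## §7 The Jacobian ideal of a form with a sign symmetry -/

section Jacobian

variable {n : ℕ}

/-- **The partials of an `a`-invariant form are eigenforms**: `(∂ᵢ f)(a • x) = aᵢ⁻¹ ∂ᵢ f` when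
`f(a • x) = f` (the tree's `aeval_diagonalSubst_pderiv_of_mem_diagonalStabilizer`, scalar form).
[cite: VoisinHodgeII2003, §6.2.2 Def. 6.18 (held text chunk p0165)] -/
theorem aeval_diagonalSubst_pderiv_eq_inv_smul {a : Fin (n + 2) → ℂˣ} {f : MvPolynomial (Fin (n + 2)) ℂ}
    (haf : a ∈ diagonalStabilizer f) (i : Fin (n + 2)) :
    aeval (diagonalSubst a) (pderiv i f) = ((a i : ℂˣ) : ℂ)⁻¹ • pderiv i f := by
  rw [aeval_diagonalSubst_pderiv_of_mem_diagonalStabilizer haf i, Units.smul_def, Units.val_inv_eq_inv_val]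

/-- **The sign-refined Hilbert function of the Jacobian ring of a form with a sign symmetry.** Let `a` be a sign
vector (`a * a = 1`) stabilising the form `f` of degree `d ≥ 2` with `aᵢᵈ = 1` for all `i` (e.g. `d` even),
and assume the Jacobian ring `S/J_f` is finite-dimensional (a power of every variable lies in `J_f`: every
nonsingular `f`). Then for `c = ±1` and every `t`:
`dim (S_t)_c − dim ((J_f)_t)_c = #{β : |β| = t, βᵢ ≤ d − 2, a^β = c}` — the `c`-part of the Fermat box count
(the unrefined statement is the tree's `hilbert_jacobianIdeal_eq_card`). [cite: Movasati2016Periods, Definition 1]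
[cite: CarlsonMullerStachPeters2017, §7.4 Thm. 7.4.1 (proof)] -/
theorem hilbertSign_jacobianIdeal_eq_card {d : ℕ} {f : MvPolynomial (Fin (n + 2)) ℂ} (hf : f.IsHomogeneous d)
    (hd : 2 ≤ d) {a : Fin (n + 2) → ℂˣ} (ha : a * a = 1) (haf : a ∈ diagonalStabilizer f)
    (had : ∀ i, ((a i : ℂˣ) : ℂ) ^ d = 1) {M : ℕ}
    (hXM : ∀ i, (X i : MvPolynomial (Fin (n + 2)) ℂ) ^ M ∈ UniversalHypersurface.jacobianIdeal (N := n + 1) f)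
    {c : ℂ} (hc : c = 1 ∨ c = -1) (t : ℕ) :
    finrank ℂ ↥(homogeneousSubmodule (Fin (n + 2)) ℂ t ⊓ Module.End.eigenspace (aeval (diagonalSubst a)).toLinearMap c) -
        finrank ℂ ↥(idealDegree (UniversalHypersurface.jacobianIdeal (N := n + 1) f) t ⊓
          Module.End.eigenspace (aeval (diagonalSubst a)).toLinearMap c) =
      (((Finset.univ : Finset (Fin (n + 2))).finsuppAntidiag t).filter
        fun β : Fin (n + 2) →₀ ℕ ↦ (∀ i, β i ≤ d - 2) ∧ (∏ i, ((a i : ℂˣ) : ℂ) ^ β i) = c).card := by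
  have hpow : ∀ i, ((a i : ℂˣ) : ℂ) ^ (d - 1) = ((a i : ℂˣ) : ℂ)⁻¹ := by
    intro i
    have h : ((a i : ℂˣ) : ℂ) ^ (d - 1) * ((a i : ℂˣ) : ℂ) = 1 := by
      rw [← pow_succ, Nat.sub_add_cancel (by omega : 1 ≤ d), had i]
    exact eq_inv_of_mul_eq_one_left h
  have h := hilbertSign_span_eq_card_of_degrees ha (fun j ↦ pderiv j f) (fun _ ↦ d - 1) (fun j ↦ hf.pderiv)
    (fun _ ↦ by omega) (fun j ↦ by rw [hpow, aeval_diagonalSubst_pderiv_eq_inv_smul haf]) hXM hc t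
  rw [show UniversalHypersurface.jacobianIdeal (N := n + 1) f = Ideal.span (Set.range fun j ↦ pderiv j f) from rfl, h]
  congr 1

end Jacobian

end Literature.AlgebraicGeometry.HodgeTheory

end
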